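import Summits.HodgeConjecture.HodgeConjecture.Theorems.LinearSystemTorelliMiddleDivisorSupportFourfoldOfLineResidue
import Summits.HodgeConjecture.HodgeConjecture.Theorems.LimitExtensionDivisorInduction
import Literature.AlgebraicGeometry.HodgeTheory.LefschetzOneOneHolds
import Literature.AlgebraicGeometry.HodgeTheory.HodgeTypeDimension
import Literature.AlgebraicGeometry.HodgeTheory.HodgeGenericQbarDescentCompactification
import HarnessLib

/-!
# Route `LinearSystemTorelli` — crux `MiddleDivisorSupportFourfold` (stmt-HodgeConjecture-2409):
# stub E of line `IdeatorFiveSketch` IS the codimension-2 slice of the Hodge conjecture over `ℚ̄`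

Helper file for the crux item stmt-HodgeConjecture-2409 (`--supports`; it closes nothing), line
`IdeatorFiveSketch` (idea `weakly-nonfactor-descent`), lead c11.

The registered SECTOR stub E `stub_qbarDivisorSupportCodimTwo` of the line asks, for a fixed
`σ : ℚ̄ →+* ℂ`, that every rational `(2,2)`-class `c'` on the complexification `W₀ ⊗_σ ℂ` of a
`ℚ̄`-scheme with smooth projective complexification die off the preimage of a PROPER Zariski-closed
`Z₀ ⊊ W₀` defined over `ℚ̄`.  Since lead c7 it is known to FOLLOW from the codimension-2 slice of
`PeriodDeficiency.HodgeConjectureQbar` (stmt-11596) alone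
(`linearSystemTorelli_qbarDivisorSupportCodimTwo_of_hcQbarCodimTwo`, the Charles–Schnell
`ℚ̄`-support fact being discharged).  This file proves the CONVERSE, so that E is recorded
kernel-checked as EQUIVALENT to that slice — not merely implied by it — and the two open inputs of
the line's residue (`linearSystemTorelli_middleDivisorSupportFourfold_of_typeStability_of_hcQbarCodimTwo`,
lead c10) are each pinned: T (type stability at `ℚ̄`-generic points) and HC/`ℚ̄`(·,2).

* `linearSystemTorelli_hcQbarCodimTwo_of_supportedClassesOne` — on the complexification of a
  `ℚ̄`-scheme with smooth projective complexification of dimension `m`, a rational `(2,2)`-class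
  supported on a COMPLEX divisor (`c' ∈ N¹H⁴`) is ALGEBRAIC: `m = 0` carries no `(2,2)`-class
  (`IsOfHodgeType.eq_zero_pp_of_lt`), and for `m = k + 1` this is the route's support item
  `DivisorInduction` (stmt-1082, PROVED: `linearSystemTorelli_divisorInduction_proof` — Deligne,
  Hodge III 8.2.8 + semisimplicity) at `p = 2`, whose codimension-1 hypothesis on `k`-folds is the
  Lefschetz theorem on `(1,1)`-classes (`lefschetzOneOne_rational_holds`, PROVED);
* `linearSystemTorelli_hcQbarCodimTwo_of_qbarDivisorSupportCodimTwo` — hence E (for `σ`) implies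
  the codimension-2 slice of HC/`ℚ̄` (for `σ`): the preimage of a proper `ℚ̄`-closed subset is a
  proper closed subset (the projection `W₀ ⊗_σ ℂ → W₀` is surjective), so `c' ∈ N¹H⁴`;
* `linearSystemTorelli_qbarDivisorSupportCodimTwo_iff_hcQbarCodimTwo` — **E(σ) ↔ HC/`ℚ̄`(·,2)(σ)**;
* `linearSystemTorelli_qbarDivisorSupportCodimTwo_of_supportedClassesOne` — **the `ℚ̄`-rationality
  of the supporting divisor is automatic**: if rational `(2,2)`-classes on such `W₀ ⊗_σ ℂ` lie in
  `N¹H⁴` (complex divisor support, the crux-type statement for `ℚ̄`-definable varieties of all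
  dimensions), then E holds — through algebraicity and the Charles–Schnell `ℚ̄`-support fact
  (`charlesSchnell2014_algebraicClasses_supportedOn_qbarClosed_holds`), with no Verdier /
  Thom–Mather spreading of supports;
* `linearSystemTorelli_stub_qbarDivisorSupportCodimTwo_iff` — the registered stub E (all `σ`)
  is equivalent to "for every `σ`, rational `(2,2)`-classes on every smooth projective
  `W₀ ⊗_σ ℂ` are algebraic".

Consequence for the line (recorded, nothing to prove): the residue of lead c10 reads
crux ⟸ T ∧ E modulo {Riemann existence over `ℂ` in covering form, Deligne's partie fixe =
stmt-16363}, with E ≡ HC/`ℚ̄` in codimension 2 (all dimensions `m ≥ 4`; `m ≤ 3` proved, p121589)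
and the crux itself ≡ HC(4,2) (p108510): both sides of Voisin's `ℚ̄`-funnel are statements of the
SAME type (algebraicity of rational `(2,2)`-classes), over `ℂ` for fourfolds downstairs and over `ℚ̄`
in all dimensions upstairs.
-/

-- every declaration of this problem lives in `Summit.HodgeConjecture.HodgeConjecture.…`
set_option linter.dupNamespace false

noncomputable section

namespace Summit.HodgeConjecture.HodgeConjecture.Theorems

open CategoryTheory AlgebraicGeometry
open _root_.Topology
open Summit.HodgeConjecture.HodgeConjecture.Theses
open Literature.AlgebraicGeometry Literature.AlgebraicGeometry.Motives
open Literature.AlgebraicGeometry.HodgeTheory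
open Literature.AlgebraicTopology.SingularHomology

/-- **A rational `(2,2)`-class supported on a complex divisor is algebraic** (on the
complexification `W₀ ⊗_σ ℂ` of a `ℚ̄`-scheme with smooth projective complexification of dimension
`m`; the statement only uses that `W₀ ⊗_σ ℂ` is smooth projective): for `m = 0` there is no non-zero
`(2,2)`-class (`IsOfHodgeType.eq_zero_pp_of_lt`); for `m = k + 1` it is the route's support item
`DivisorInduction` (stmt-HodgeConjecture-1082, PROVED as `linearSystemTorelli_divisorInduction_proof`:
Deligne, Hodge III Cor. 8.2.8, semisimplicity of polarisable Hodge structures, push-forward) at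
`p = 2`, fed with the Lefschetz theorem on `(1,1)`-classes on smooth projective `k`-folds
(`lefschetzOneOne_rational_holds`). [cite: DeligneHodgeIII1974, Prop. 8.2.7 and Cor. 8.2.8]
[cite: Thomas2005Nodes, §2] [cite: VoisinHodgeI2002, Thm. 11.30] -/
theorem linearSystemTorelli_hcQbarCodimTwo_of_supportedClassesOne (σ : AlgebraicClosure ℚ →+* ℂ)
    {m : ℕ} {W₀ : SchemeOver (AlgebraicClosure ℚ)} (hW : IsSmoothProjective m ((baseChangeHom σ).obj W₀))
    (c' : complexBetti ((baseChangeHom σ).obj W₀) 4) (hc' : IsRationalClass c')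
    (hh' : IsOfHodgeType m ((baseChangeHom σ).obj W₀) 4 2 2 c')
    (hmem : c' ∈ supportedClasses ((baseChangeHom σ).obj W₀) 4 1) :
    c' ∈ algebraicClasses ((baseChangeHom σ).obj W₀) 2 := by
  rcases m with _ | k
  · -- dimension `0`: no non-zero `(2,2)`-class
    have h0 : c' = 0 := IsOfHodgeType.eq_zero_pp_of_lt (p := 2) hh' (by norm_num)
    rw [h0]
    exact Submodule.zero_mem _
  · -- dimension `k + 1`: divisor induction at `p = 2` with Lefschetz `(1,1)` on `k`-folds
    exact linearSystemTorelli_divisorInduction_proof k 2 (by norm_num)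
      (fun Y hY c hc hh ↦ lefschetzOneOne_rational_holds hY c hc hh) hW c' hc' hh' hmem

/-- **E(σ) ⟹ HC/`ℚ̄`(·,2)(σ).** If every rational `(2,2)`-class on every `W₀ ⊗_σ ℂ` (smooth
projective complexification of a `ℚ̄`-scheme) dies off the preimage of a proper Zariski-closed
`Z₀ ⊊ W₀`, then every such class is algebraic: the preimage `π⁻¹ Z₀` under the (surjective)
projection `π : W₀ ⊗_σ ℂ → W₀` is a proper closed subset, all of whose points have codimension `≥ 1`
in the integral `W₀ ⊗_σ ℂ` (`one_le_coheight_of_mem_of_isClosed`), so `c' ∈ N¹H⁴`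
(`mem_supportedClasses_of_restrictCompl_eq_zero`) and
`linearSystemTorelli_hcQbarCodimTwo_of_supportedClassesOne` applies.
[cite: DeligneHodgeIII1974, Cor. 8.2.8] [cite: GrothendieckTopology1969, §1] -/
theorem linearSystemTorelli_hcQbarCodimTwo_of_qbarDivisorSupportCodimTwo (σ : AlgebraicClosure ℚ →+* ℂ)
    (hE : ∀ ⦃m : ℕ⦄ (W₀ : SchemeOver (AlgebraicClosure ℚ)),
      IsSmoothProjective m ((baseChangeHom σ).obj W₀) →
      ∀ (c' : complexBetti ((baseChangeHom σ).obj W₀) 4), IsRationalClass c' →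
        IsOfHodgeType m ((baseChangeHom σ).obj W₀) 4 2 2 c' →
          ∃ Z₀ : Set W₀.left, IsClosed Z₀ ∧ Z₀ ≠ Set.univ ∧
            complexBetti.restrictCompl ((baseChangeHom σ).obj W₀)
              ((baseChangeHomFst σ W₀).base ⁻¹' Z₀) 4 c' = 0) :
    ∀ ⦃m : ℕ⦄ ⦃W₀ : SchemeOver (AlgebraicClosure ℚ)⦄,
      IsSmoothProjective m ((baseChangeHom σ).obj W₀) →
        ∀ (c' : complexBetti ((baseChangeHom σ).obj W₀) 4), IsRationalClass c' →
          IsOfHodgeType m ((baseChangeHom σ).obj W₀) 4 2 2 c' →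
            c' ∈ algebraicClasses ((baseChangeHom σ).obj W₀) 2 := by
  intro m W₀ hW c' hc' hh'
  obtain ⟨Z₀, hZ₀, hZ₀ne, hd⟩ := hE W₀ hW c' hc' hh'
  have hclosed : IsClosed ((baseChangeHomFst σ W₀).base ⁻¹' Z₀) :=
    hZ₀.preimage (baseChangeHomFst σ W₀).base.hom.continuous
  have hne : (baseChangeHomFst σ W₀).base ⁻¹' Z₀ ≠ Set.univ :=
    linearSystemTorelli_preimage_ne_univ_of_denseRange
      (surjective_baseChangeHomFst σ W₀).surj.denseRange hZ₀ hZ₀ne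
  refine linearSystemTorelli_hcQbarCodimTwo_of_supportedClassesOne σ hW c' hc' hh'
    (mem_supportedClasses_of_restrictCompl_eq_zero hclosed (fun z hz ↦ ?_) hd)
  exact_mod_cast one_le_coheight_of_mem_of_isClosed hW hclosed hne hz

/-- **E(σ) ↔ HC/`ℚ̄`(·,2)(σ)**: for a fixed `σ : ℚ̄ →+* ℂ`, "every rational `(2,2)`-class on every
`W₀ ⊗_σ ℂ` (smooth projective complexification) dies off the preimage of a proper `ℚ̄`-closed
`Z₀ ⊊ W₀`" is EQUIVALENT to "every such class is algebraic" — `→` by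
`linearSystemTorelli_hcQbarCodimTwo_of_qbarDivisorSupportCodimTwo` (divisor induction + Lefschetz
`(1,1)`), `←` by `linearSystemTorelli_qbarDivisorSupportCodimTwo_of_hcQbarCodimTwo` (lead c7: the
Charles–Schnell `ℚ̄`-support of algebraic classes, discharged). So the registered sector stub E of
line `IdeatorFiveSketch` is exactly the codimension-2 slice of stmt-11596.
[cite: CharlesSchnell2014Notes, Remark after Cor. 11.3.16] [cite: DeligneHodgeIII1974, Cor. 8.2.8] -/
theorem linearSystemTorelli_qbarDivisorSupportCodimTwo_iff_hcQbarCodimTwo (σ : AlgebraicClosure ℚ →+* ℂ) :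
    (∀ ⦃m : ℕ⦄ (W₀ : SchemeOver (AlgebraicClosure ℚ)),
      IsSmoothProjective m ((baseChangeHom σ).obj W₀) →
      ∀ (c' : complexBetti ((baseChangeHom σ).obj W₀) 4), IsRationalClass c' →
        IsOfHodgeType m ((baseChangeHom σ).obj W₀) 4 2 2 c' →
          ∃ Z₀ : Set W₀.left, IsClosed Z₀ ∧ Z₀ ≠ Set.univ ∧
            complexBetti.restrictCompl ((baseChangeHom σ).obj W₀)
              ((baseChangeHomFst σ W₀).base ⁻¹' Z₀) 4 c' = 0) ↔
    (∀ ⦃m : ℕ⦄ ⦃W₀ : SchemeOver (AlgebraicClosure ℚ)⦄,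
      IsSmoothProjective m ((baseChangeHom σ).obj W₀) →
        ∀ (c' : complexBetti ((baseChangeHom σ).obj W₀) 4), IsRationalClass c' →
          IsOfHodgeType m ((baseChangeHom σ).obj W₀) 4 2 2 c' →
            c' ∈ algebraicClasses ((baseChangeHom σ).obj W₀) 2) :=
  ⟨linearSystemTorelli_hcQbarCodimTwo_of_qbarDivisorSupportCodimTwo σ,
    fun hQ2 _ W₀ ↦ linearSystemTorelli_qbarDivisorSupportCodimTwo_of_hcQbarCodimTwo σ hQ2 W₀⟩

/-- **The `ℚ̄`-rationality of the supporting divisor is automatic** (for a fixed `σ`): if rational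
`(2,2)`-classes on every `W₀ ⊗_σ ℂ` (smooth projective complexification of a `ℚ̄`-scheme, any
dimension) are supported on a COMPLEX divisor — `c' ∈ N¹H⁴`, the crux-type statement for
`ℚ̄`-definable varieties — then each dies off the preimage of a proper Zariski-closed `Z₀ ⊊ W₀`
DEFINED OVER `ℚ̄` (stub E): a divisor-supported rational `(2,2)`-class is algebraic
(`linearSystemTorelli_hcQbarCodimTwo_of_supportedClassesOne`), and algebraic classes have
`ℚ̄`-rational proper supports (Charles–Schnell, `charlesSchnell2014_algebraicClasses_supportedOn_qbarClosed_holds`,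
through `linearSystemTorelli_qbarDivisorSupportCodimTwo_of_hcQbarCodimTwo`). No spreading of
supports (Verdier / Thom–Mather) is needed in codimension 2.
[cite: CharlesSchnell2014Notes, Remark after Cor. 11.3.16] [cite: DeligneHodgeIII1974, Cor. 8.2.8] -/
theorem linearSystemTorelli_qbarDivisorSupportCodimTwo_of_supportedClassesOne (σ : AlgebraicClosure ℚ →+* ℂ)
    (hN : ∀ ⦃m : ℕ⦄ ⦃W₀ : SchemeOver (AlgebraicClosure ℚ)⦄,
      IsSmoothProjective m ((baseChangeHom σ).obj W₀) →
        ∀ (c' : complexBetti ((baseChangeHom σ).obj W₀) 4), IsRationalClass c' →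
          IsOfHodgeType m ((baseChangeHom σ).obj W₀) 4 2 2 c' →
            c' ∈ supportedClasses ((baseChangeHom σ).obj W₀) 4 1) :
    ∀ ⦃m : ℕ⦄ (W₀ : SchemeOver (AlgebraicClosure ℚ)),
      IsSmoothProjective m ((baseChangeHom σ).obj W₀) →
      ∀ (c' : complexBetti ((baseChangeHom σ).obj W₀) 4), IsRationalClass c' →
        IsOfHodgeType m ((baseChangeHom σ).obj W₀) 4 2 2 c' →
          ∃ Z₀ : Set W₀.left, IsClosed Z₀ ∧ Z₀ ≠ Set.univ ∧
            complexBetti.restrictCompl ((baseChangeHom σ).obj W₀)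
              ((baseChangeHomFst σ W₀).base ⁻¹' Z₀) 4 c' = 0 :=
  fun _ W₀ ↦ linearSystemTorelli_qbarDivisorSupportCodimTwo_of_hcQbarCodimTwo σ
    (fun _ _ hW c' hc' hh' ↦
      linearSystemTorelli_hcQbarCodimTwo_of_supportedClassesOne σ hW c' hc' hh' (hN hW c' hc' hh')) W₀

/-- **The registered stub E (all `σ`) ↔ "rational `(2,2)`-classes on every smooth projective
`W₀ ⊗_σ ℂ` are algebraic, for every `σ`"** — the left-hand side is VERBATIM the signature of
`stub_qbarDivisorSupportCodimTwo` of line `IdeatorFiveSketch` (skeleton v10); the right-hand side is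
the codimension-2 slice of `PeriodDeficiency.HodgeConjectureQbar` (stmt-11596) spelled without the
bundled `HodgeConjectureFor`. [cite: CharlesSchnell2014Notes, Remark after Cor. 11.3.16]
[cite: DeligneHodgeIII1974, Cor. 8.2.8] -/
theorem linearSystemTorelli_stub_qbarDivisorSupportCodimTwo_iff :
    (∀ (σ : AlgebraicClosure ℚ →+* ℂ) ⦃m : ℕ⦄ (W₀ : SchemeOver (AlgebraicClosure ℚ)),
      IsSmoothProjective m ((baseChangeHom σ).obj W₀) →
      ∀ (c' : complexBetti ((baseChangeHom σ).obj W₀) 4), IsRationalClass c' →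
        IsOfHodgeType m ((baseChangeHom σ).obj W₀) 4 2 2 c' →
          ∃ Z₀ : Set W₀.left, IsClosed Z₀ ∧ Z₀ ≠ Set.univ ∧
            complexBetti.restrictCompl ((baseChangeHom σ).obj W₀)
              ((baseChangeHomFst σ W₀).base ⁻¹' Z₀) 4 c' = 0) ↔
    (∀ (σ : AlgebraicClosure ℚ →+* ℂ) ⦃m : ℕ⦄ ⦃W₀ : SchemeOver (AlgebraicClosure ℚ)⦄,
      IsSmoothProjective m ((baseChangeHom σ).obj W₀) →
        ∀ (c' : complexBetti ((baseChangeHom σ).obj W₀) 4), IsRationalClass c' →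
          IsOfHodgeType m ((baseChangeHom σ).obj W₀) 4 2 2 c' →
            c' ∈ algebraicClasses ((baseChangeHom σ).obj W₀) 2) :=
  ⟨fun hE σ ↦ (linearSystemTorelli_qbarDivisorSupportCodimTwo_iff_hcQbarCodimTwo σ).1 (hE σ),
    fun hQ σ ↦ (linearSystemTorelli_qbarDivisorSupportCodimTwo_iff_hcQbarCodimTwo σ).2 (hQ σ)⟩

end Summit.HodgeConjecture.HodgeConjecture.Theorems

end
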